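import Mathlib.Tactic.NormNum.Prime
import Mathlib.RepresentationTheory.Invariants
import Literature.AlgebraicGeometry.Hyperkaehler.GeneralizedKummerTypeTranslationGroup
import Literature.AlgebraicGeometry.Hyperkaehler.GeneralizedKummerTypeLefschetzStandardDegrees
import Literature.AlgebraicGeometry.Hyperkaehler.GeneralizedKummerBettiNumbers
import Literature.AlgebraicGeometry.HodgeTheory.VanishingCohomologyNontrivialProofs
import HarnessLib

/-!
# The translation group `Γ(X) ≅ (ℤ/(n+1))⁴` acting on the cohomology of a variety of `Kumⁿ`-type, ALL `n` — Foster 2024 §5.2 (Lemma 85, Prop. 87, Rem. 88): NAMED FACT + kernel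

Layer `Literature/AlgebraicGeometry/Hyperkaehler`.  The GENERAL FORM (every `n ≥ 2`; prime levels
`n + 1 = p`) of the `n = 4` record `Foster2024_translationAction_kum4Type` of
`GeneralizedKummerTypeTranslationGroup` — that file's own `-- TODO(general form): Foster's bound
k < 2(n+1)(j-1)/j … and the regular representation in degree 2n for n + 1 prime`.  Typed (seat
`hodge-lit-oqh-2`, gen 8) for the consumer that named it: lens seat `vhodge-oqh-3`, memo
run/shared/lean/pub/vhodge/memos/OQH3-g0-twisted-diagonal.md §8 (R1), whose typed candidate for the
`Kumⁿ` / Kummer-moduli prime-level rung takes as PRINT INPUTS `KumTranslationGroupPrime n`,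
`KumTranslationGroupTrivialOffMiddle n` — the general-`n` shapes of the `hodge-kum4` cell's
`Kum4TranslationGroup` / `…TrivialOffMiddle`, which for `n = 4` "close by transcription" of the `n = 4`
record (for general `n` there was nothing to transcribe from).  HONEST FRAMING: one new named fact
(REFEREED source, unproved in the tree) + kernel theorems; nothing here asserts the Hodge statement for
any variety of `Kumⁿ`-type, nor `HC ∕ HC_AV ∕ W₆ ∕ HC_Kum4Type`; typed ≠ proved ≠ endorsed.  No record of
the `hodge-kum4` cell is edited: the `n = 4` record is RECOVERED BY NAME (`….kum4Type`).

## Source, read at the cited lines (held text `paper:arxiv-2303.14327`; journal numbering)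

J. Foster, *The Lefschetz standard conjectures for IHSMs of generalized Kummer deformation type in
certain degrees*, Eur. J. Math. 10 (2024), art. 41 [`Foster2024`, REFEREED].  Setting (§5, p0019 L3–L11;
Rem. 28 and Lemma 29 = Hassett–Tschinkel, p0008 L51–L55): `Γ = Γ_w ≅ A[n+1] ⊂ Aut₀(Kum_n(A))` ("the
group `A[n+1]` of torsion points […] embeds into `Aut₀(Kum_n(A))`"; "`Aut₀(Kum_n(A))` is a deformation
invariant of `Kum_n(A)`. The action of `Γ_w` […] extends to a natural action on any deformation of
`Kum_n(A)`"), carried as a local system over a connected component `𝔐⁰_{w^⊥}` of the marked moduli space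
containing `(Kum_n(A), η)` (p0011 L5–L20, L43: every `Y` of the type, suitably marked, lies in it);
`Y_t` = the fibre at `t`.
* **Lemma 85** (p0024 L141 – p0025 L29), VERBATIM: "Let `j > 1` be the smallest prime divisor of `n+1`.
  The pullback map `i^* : H^*(𝓜_t, ℚ) → H^*(Y_t, ℚ)` is surjective in degrees `< 2(n+1)(j-1)/j`";
  proof, last lines: "if `k < 2(n+1)(j-1)/j`, then `H^k(A × Kum_n(A), ℚ)` is `Γ`-invariant and by the
  Künneth theorem this implies that `H^k(Kum_n(A), ℚ)` is `Γ`-invariant as well. `H^k(Y_t, ℚ)` is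
  therefore `Γ`-invariant by Lemma (deformation invariant)."
* **Prop. 87** (`n + 1` prime; p0025 L54–L65 = Example 3, p0024 L101–L110), VERBATIM: "The direct sum
  `⊕_{γ ∈ Γ} H^{2n+2}(A × W^γ_{(n+1)}, ℚ)` is a `Γ`-regular representation. The equivariance properties of
  the isomorphism (GS) yields a `Γ`-regular representation in the middle cohomology of `A × Kum_n(A)`."
* **Remark 88** (`n + 1` prime; p0025 L67–L71), VERBATIM: "the image of `i^* : H^k(𝓜_t, ℚ) → H^k(Y_t, ℚ)`
  is surjective in all degrees `k < 2n`. In the middle degree `k = 2n`, Theorem (GS Theorem 7) and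
  Proposition (regular representation) imply that `H^{2n}(Y_t, ℚ)` is spanned by a `Γ`-regular
  representation. The prior classes are `Γ`-invariant".
* `Γ` = this directory's `Γ(X) = autFixingH2H3 X` (automorphisms trivial on `H²(X(ℂ); ℂ)` and
  `H³(X(ℂ); ℂ)`) by the printed sentence of Floccari–Varesco, Math. Ann. (2025) §3 ¶1 [`FloccariVaresco2024`,
  REFEREED; arXiv:2308.04865 p. 6 L4]: "The automorphisms of `X` which act trivially on its second and third
  cohomology groups form a group `Γₙ ≅ (ℤ/(n+1)ℤ)⁴`, by [BNWS, Hassett–Tschinkel]" — the tree's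
  `FloccariVaresco2024_autFixingH2H3_equiv_kumType`; the same rendering as the `n = 4` record.

## The statement typed and its faithfulness (grades per clause)

`Foster2024_translationAction_kumType`: for every `n ≥ 2` and every smooth projective `X` of `Kumⁿ`-type
(binders `Motives.IsSmoothProjective (2 * n) X`, `IsOfGeneralizedKummerType n X`, as every record here):
* (L) [Lemma 85, ALL `n`; FAITHFUL (`ℚ` ⟹ `ℂ`), REFEREED] for every `k` with `j·k + 2(n+1) < 2(n+1)·j`,
  `j = (n + 1).minFac` — the integer form of `k < 2(n+1)(j-1)/j`, token-identical with the hypothesis of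
  `Foster2024_lefschetzStandard_kummerType_degrees` (`degreeBound_iff` there) — every `g ∈ Γ(X)` acts as
  the identity on `Hᵏ(X(ℂ); ℂ)`;
* (P) [`n + 1` prime] (ii) every `g ∈ Γ(X)` acts as the identity on `Hᵏ(X(ℂ); ℂ)`, `k ≠ 2n` (`k < 2n`:
  Rem. 88 / (L) with `j = n + 1`, REFEREED; `k > 2n`: `Γ`-equivariant Poincaré duality, standard, NOT
  spelled out in print — PRINT-SYNTHESIS, the very caveat of the `n = 4` record's clause (ii));
  (iii) `H^{2n}(X(ℂ); ℂ)` is spanned by the `Γ(X)`-invariants and the `Γ(X)`-ORBIT of ONE class `v` —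
  exactly "spanned by [the invariant prior classes and] a `Γ`-regular representation" (the image of an
  equivariant map from `k[Γ]` is the span of the orbit of the image of `δ₁`, and conversely; FAITHFUL,
  WEAKER-or-equal over `ℂ`); (iii′) the same on `H^{2n}(X(ℂ); ℝ)`, the carrier of `translationRepReal`
  (the `n = 4` record's clause (i′)).
PROVED here: from (iii)/(iii′) (§ OrbitSpan: `V = V^G + span(G·v)` ⟹ `𝒦 = span{ρ(g)c − c}` lies in
the span of the `|G| − 1` vectors `ρ(g)v − v`, `g ≠ 1`) and `|Γ(X)| = (n+1)⁴`
(`FloccariVaresco2024_autFixingH2H3_equiv_kumType.card_eq`) the DIMENSION form `dim 𝒦(H^{2n}) ≤ (n+1)⁴ − 1`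
over `ℂ` and `ℝ` — for `n = 4` the clauses (i), (i′) "`≤ 624`" of the `n = 4` record, recovered by name
(`kum4Type`).  The new record is STRONGER (all `n`; one-orbit form = every non-trivial character of the
abelian `Γ(X)` has multiplicity `≤ 1` in `H^{2n}`), not a restatement.

NOT typed, with reasons.  (a) Prop. 82 (the `ℚ[Γ]`-ISOMORPHISM with the Göttsche–Soergel strata — no
carriers); from it and Künneth one DERIVES `dim 𝒦(H^{2n}) = (n+1)⁴ − 1` exactly (the non-invariant part
of `H^*(Kum_n A)` has Poincaré series `((n+1)⁴ − 1)·t^{2n}`) — synthesis, no consumer (numerically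
`108 = 28 + 80`, Hassett–Tschinkel 2013 Prop. 4.1 "`H⁴(X) = Sym²(H²(X)) ⊕ 1⁸⁰`" [arXiv:1004.0046 p0005
L11–L20]; `1046 = 422 + 624`).  (b) Prop. 87's last sentence "in degree `k ≠ 2n+2` the pullback
`Γ`-action on `H^k(A × Kum_n(A), ℚ)` is trivial": read literally it is inconsistent with Künneth + Rem. 88
(the sector `ν = (n+1)` contributes `H^{k-2n}(A) ⊗ (regular)` in every degree `2n ≤ k ≤ 2n+4`; e.g.
`H¹(A) ⊗ H^{2n}(Kum_n A) ⊂ H^{2n+1}` carries `4·((n+1)⁴−1)` non-invariant dimensions) — the sentence used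
downstream (Rem. 88, for `Y`) is the one typed.  (c) `𝓜_t`, `i^*`, the LSC consequences (=
`Foster2024_lefschetzStandard_kummerType_degrees` /`_prime`); `|Γ(X)| = (n+1)⁴` (= the FV record).

Kernel: § OrbitSpan (`coinvariantsKer_le_span_orbit_sub`, `finrank_coinvariantsKer_le_of_orbit_span`);
accessors; `translationRep_apply_of_degreeBound` /`_of_prime_of_lt` /`_of_even_of_lt`, `kum5Type_four_five`
(`Γ` trivial on `H⁴, H⁵` of `Kum⁵`-type); prime level `map_eq_id_of_ne`, `translationRep_apply_of_ne`,
`coinvariantsKer_eq_bot_of_ne`, `exists_orbit_span`, `finrank_coinvariantsKer_le` /`_real_le`;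
`kum4Type` (⟹ the `n = 4` record), `kum2Type` (`≤ 80` in `H⁴`, trivial off degree `4`); Göttsche
consistency `le_finrank_coinvariants_kum2Type` /`_kum4Type` (coinvariants of `H⁴` / `H⁸` have dimension
`≥ 108 − 80 = 28` / `≥ 1046 − 624 = 422`; print: `28 = dim Sym² H²`, HT13; `422`, as quoted in the `n = 4` file).
-/
noncomputable section

open CategoryTheory
open Literature.AlgebraicGeometry.HodgeTheory

namespace Literature.AlgebraicGeometry.Hyperkaehler

/-! ### § OrbitSpan — a representation spanned by its invariants and ONE orbit -/

section OrbitSpan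

variable {k G V : Type*} [Field k] [Group G] [AddCommGroup V] [Module k V]
  (ρ : Representation k G V)

/-- If `V` is spanned by the `ρ`-invariants and the orbit of one vector `v`, then the augmentation
submodule `𝒦 = span{ρ(g)c − c}` (Mathlib's `Representation.Coinvariants.ker`) is contained in the
span of the vectors `ρ(g)v − v`, `g ∈ G` — the elementary span form of "the regular representation
contains every irreducible `dim V` times", used to read Foster's Remark 88.
[cite: FultonHarris1991, §2.2 Cor. 2.18 (regular representation)] [cite: Foster2024, Remark 88] -/
theorem coinvariantsKer_le_span_orbit_sub (v : V)
    (hv : ∀ c : V, c ∈ ρ.invariants ⊔ Submodule.span k (Set.range fun g : G => ρ g v)) :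
    Representation.Coinvariants.ker ρ ≤ Submodule.span k (Set.range fun g : G => ρ g v - v) := by
  set S : Submodule k V := Submodule.span k (Set.range fun g : G => ρ g v - v) with hS
  -- for every `h ∈ G`: `ρ h s - s ∈ S` whenever `s` lies in the span of the orbit of `v`
  have key : ∀ (h : G), ∀ s ∈ Submodule.span k (Set.range fun g : G => ρ g v), ρ h s - s ∈ S := by
    intro h s hs
    induction hs using Submodule.span_induction with
    | mem x hx =>
      obtain ⟨g, rfl⟩ := hx
      have e : ρ h (ρ g v) - ρ g v = (ρ (h * g) v - v) - (ρ g v - v) := by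
        rw [map_mul, Module.End.mul_apply]; abel
      rw [e]
      exact S.sub_mem (Submodule.subset_span ⟨h * g, rfl⟩) (Submodule.subset_span ⟨g, rfl⟩)
    | zero => simp
    | add x y _ _ hx hy =>
      have e : ρ h (x + y) - (x + y) = (ρ h x - x) + (ρ h y - y) := by rw [map_add]; abel
      rw [e]
      exact S.add_mem hx hy
    | smul a x _ hx =>
      have e : ρ h (a • x) - a • x = a • (ρ h x - x) := by rw [map_smul, smul_sub]
      rw [e]
      exact S.smul_mem a hx
  rw [Representation.Coinvariants.ker, Submodule.span_le]
  rintro _ ⟨⟨h, c⟩, rfl⟩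
  obtain ⟨i, hi, s, hs, rfl⟩ := Submodule.mem_sup.1 (hv c)
  have hi' : ρ h i = i := (ρ.mem_invariants i).1 hi h
  have e : ρ h (i + s) - (i + s) = ρ h s - s := by rw [map_add, hi']; abel
  change ρ h (i + s) - (i + s) ∈ S
  rw [e]
  exact key h s hs

/-- **`dim 𝒦 ≤ |G| − 1`** when `V` is spanned by the invariants and one orbit (`G` finite): the `|G| − 1`
vectors `ρ(g)v − v`, `g ≠ 1`, span a submodule containing `𝒦` (the augmentation ideal of `k[G]` has
dimension `|G| − 1`). [cite: FultonHarris1991, §2.2 Cor. 2.18 (regular representation)] [cite: Foster2024, Remark 88] -/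
theorem finrank_coinvariantsKer_le_of_orbit_span [Finite G] (v : V)
    (hv : ∀ c : V, c ∈ ρ.invariants ⊔ Submodule.span k (Set.range fun g : G => ρ g v)) :
    Module.finrank k (Representation.Coinvariants.ker ρ) ≤ Nat.card G - 1 := by
  classical
  letI := Fintype.ofFinite G
  let b : {g : G // ¬ g = 1} → V := fun g => ρ g.1 v - v
  have hle : Representation.Coinvariants.ker ρ ≤ Submodule.span k (Set.range b) := by
    refine (coinvariantsKer_le_span_orbit_sub ρ v hv).trans ?_
    rw [Submodule.span_le]
    rintro _ ⟨g, rfl⟩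
    change ρ g v - v ∈ Submodule.span k (Set.range b)
    by_cases hg : g = 1
    · have e : ρ g v - v = 0 := by rw [hg, map_one, Module.End.one_apply, sub_self]
      rw [e]
      exact Submodule.zero_mem _
    · exact Submodule.subset_span ⟨⟨g, hg⟩, rfl⟩
  haveI : Module.Finite k (Submodule.span k (Set.range b)) :=
    Module.Finite.span_of_finite k (Set.finite_range b)
  have hcard : Fintype.card {g : G // ¬ g = 1} = Nat.card G - 1 := by
    rw [Fintype.card_subtype_compl, Fintype.card_subtype_eq, Nat.card_eq_fintype_card]
  calc Module.finrank k (Representation.Coinvariants.ker ρ)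
      ≤ Module.finrank k (Submodule.span k (Set.range b)) := Submodule.finrank_mono hle
    _ ≤ Fintype.card {g : G // ¬ g = 1} := by
        simpa only [Set.finrank] using finrank_range_le_card (R := k) b
    _ = Nat.card G - 1 := hcard

end OrbitSpan

/-! ### The named fact (general form of `Foster2024_translationAction_kum4Type`) -/

/-- **Foster 2024 — the action of the translation group `Γ(X)` on the cohomology of a smooth projective
`X` of `Kumⁿ`-type, every `n ≥ 2`.**  (L) Lemma 85 (ALL `n`): for every degree `k` with
`j·k + 2(n+1) < 2(n+1)·j`, `j = (n + 1).minFac` the least prime factor of `n + 1` (the integer form of the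
printed `k < 2(n+1)(j−1)/j`), every `g ∈ Γ(X)` acts as the identity on `Hᵏ(X(ℂ); ℂ)` ("`H^k(Y_t, ℚ)` is
`Γ`-invariant").  (P) `n + 1` PRIME (Prop. 87, Rem. 88): (ii) every `g ∈ Γ(X)` acts as the identity on
`Hᵏ(X(ℂ); ℂ)` for every `k ≠ 2n` (`k < 2n`: "surjective in all degrees `k < 2n`", = (L); `k > 2n`:
`Γ`-equivariant Poincaré duality — standard, not spelled out in print); (iii) `H^{2n}(X(ℂ); ℂ)` is
spanned by the `Γ(X)`-invariant classes and the `Γ(X)`-orbit of ONE class ("`H^{2n}(Y_t, ℚ)` is spanned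
by a `Γ`-regular representation. The prior classes are `Γ`-invariant"); (iii′) the same on
`H^{2n}(X(ℂ); ℝ)`.  `Γ(X) = autFixingH2H3 X` is Foster's `Γ ≅ A[n+1]` carried along deformations
(Hassett–Tschinkel, Foster's Lemma 29) by Floccari–Varesco's sentence "the automorphisms of `X` which act
trivially on its second and third cohomology groups form a group `Γₙ ≅ (ℤ/(n+1)ℤ)⁴`".  The `ℚ`-statements
imply the `ℂ`/`ℝ`-statements.  A THEOREM in print (REFEREED), unproved in the tree; its `n = 4` instance
in dimension form is `Foster2024_translationAction_kum4Type` (recovered below, `kum4Type`).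
[cite: Foster2024, Lemma 85 (§5.2, arXiv:2303.14327 p. 24 L141 – p. 25 L29), Prop. 87 and Remark 88 (p. 25 L54–L71)]
[cite: FloccariVaresco2024, §3 first paragraph (arXiv:2308.04865 p. 6 L4)]
[cite: HassettTschinkel2010, Thm. 2.1 (deformation invariance of the automorphisms acting trivially on H²)] -/
def Foster2024_translationAction_kumType : Prop :=
  ∀ (n : ℕ), 2 ≤ n → ∀ ⦃X : Motives.SchemeOver ℂ⦄, Motives.IsSmoothProjective (2 * n) X →
    IsOfGeneralizedKummerType n X →
      (∀ (k : ℕ), (n + 1).minFac * k + 2 * (n + 1) < 2 * (n + 1) * (n + 1).minFac →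
          ∀ g : Aut X, g ∈ autFixingH2H3 X → complexBetti.map g.hom k = 𝟙 _) ∧
      ((n + 1).Prime →
        (∀ (k : ℕ), k ≠ 2 * n → ∀ g : Aut X, g ∈ autFixingH2H3 X → complexBetti.map g.hom k = 𝟙 _) ∧
        (∃ v : complexBetti X (2 * n), ∀ c : complexBetti X (2 * n),
            c ∈ (translationRep X (2 * n)).invariants ⊔
              Submodule.span ℂ (Set.range fun g : autFixingH2H3 X => translationRep X (2 * n) g v)) ∧
        (∃ v : Literature.AlgebraicTopology.SingularHomology.singularCohomology ℝ ℝ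
            (Motives.ComplexPoints X) (2 * n),
          ∀ c, c ∈ (translationRepReal X (2 * n)).invariants ⊔
            Submodule.span ℝ (Set.range fun g : autFixingH2H3 X => translationRepReal X (2 * n) g v)))

namespace Foster2024_translationAction_kumType

/-! #### Part (L): Foster's degree range, all `n ≥ 2` -/

/-- Lemma 85: in Foster's degree range `Γ(X)` acts trivially, `g^* = 1` on `Hᵏ(X(ℂ); ℂ)`. [cite: Foster2024, Lemma 85] -/
theorem map_eq_id_of_degreeBound (h : Foster2024_translationAction_kumType) {n : ℕ} (hn : 2 ≤ n)
    {X : Motives.SchemeOver ℂ} (hX : Motives.IsSmoothProjective (2 * n) X)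
    (hK : IsOfGeneralizedKummerType n X) {k : ℕ}
    (hk : (n + 1).minFac * k + 2 * (n + 1) < 2 * (n + 1) * (n + 1).minFac)
    (g : Aut X) (hg : g ∈ autFixingH2H3 X) : complexBetti.map g.hom k = 𝟙 _ :=
  (h n hn hX hK).1 k hk g hg

/-- Lemma 85 on the representation: `ρ(g) c = c` on `Hᵏ(X(ℂ); ℂ)` for `k` in Foster's range.
[cite: Foster2024, Lemma 85] -/
theorem translationRep_apply_of_degreeBound (h : Foster2024_translationAction_kumType) {n : ℕ}
    (hn : 2 ≤ n) {X : Motives.SchemeOver ℂ} (hX : Motives.IsSmoothProjective (2 * n) X)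
    (hK : IsOfGeneralizedKummerType n X) {k : ℕ}
    (hk : (n + 1).minFac * k + 2 * (n + 1) < 2 * (n + 1) * (n + 1).minFac)
    (g : autFixingH2H3 X) (c : complexBetti X k) : translationRep X k g c = c := by
  rw [translationRep_apply, h.map_eq_id_of_degreeBound hn hX hK hk _ (g⁻¹).2]
  rfl

/-- `n + 1` prime, `k < 2n`: `ρ(g) c = c` (Rem. 88: "surjective in all degrees `k < 2n`").
[cite: Foster2024, Remark 88] -/
theorem translationRep_apply_of_prime_of_lt (h : Foster2024_translationAction_kumType) {n : ℕ}
    (hn : 2 ≤ n) (hp : (n + 1).Prime) {X : Motives.SchemeOver ℂ}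
    (hX : Motives.IsSmoothProjective (2 * n) X) (hK : IsOfGeneralizedKummerType n X) {k : ℕ}
    (hk : k < 2 * n) (g : autFixingH2H3 X) (c : complexBetti X k) : translationRep X k g c = c :=
  h.translationRep_apply_of_degreeBound hn hX hK
    (Foster2024_lefschetzStandard_kummerType_degrees.degreeBound_of_prime hp hk) g c

/-- `n + 1` even (`j = 2`), `k < n + 1`: `ρ(g) c = c` — e.g. `Kum³`: nothing beyond `H², H³`; `Kum⁵`:
`Γ` acts trivially on `H⁴` and `H⁵`. [cite: Foster2024, Lemma 85 and Cor. 3] -/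
theorem translationRep_apply_of_even_of_lt (h : Foster2024_translationAction_kumType) {n : ℕ}
    (hn : 2 ≤ n) (he : 2 ∣ n + 1) {X : Motives.SchemeOver ℂ}
    (hX : Motives.IsSmoothProjective (2 * n) X) (hK : IsOfGeneralizedKummerType n X) {k : ℕ}
    (hk : k < n + 1) (g : autFixingH2H3 X) (c : complexBetti X k) : translationRep X k g c = c :=
  h.translationRep_apply_of_degreeBound hn hX hK
    (Foster2024_lefschetzStandard_kummerType_degrees.degreeBound_of_even he hk) g c

/-- `Kum⁵`-type (`n + 1 = 6`): `Γ(X) ≅ (ℤ/6)⁴` acts trivially on `H⁴(X(ℂ); ℂ)` and `H⁵(X(ℂ); ℂ)`.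
[cite: Foster2024, Lemma 85 and Cor. 3] -/
theorem kum5Type_four_five (h : Foster2024_translationAction_kumType) {X : Motives.SchemeOver ℂ}
    (hX : Motives.IsSmoothProjective 10 X) (hK : IsOfGeneralizedKummerType 5 X)
    (g : autFixingH2H3 X) :
    (∀ c : complexBetti X 4, translationRep X 4 g c = c) ∧
      ∀ c : complexBetti X 5, translationRep X 5 g c = c :=
  ⟨fun c ↦ h.translationRep_apply_of_even_of_lt (by norm_num) (by norm_num) hX hK (by norm_num) g c,
    fun c ↦ h.translationRep_apply_of_even_of_lt (by norm_num) (by norm_num) hX hK (by norm_num) g c⟩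

/-! #### Part (P): prime level `n + 1 = p` -/

/-- Clause (ii): off the middle degree `g^* = 1`. [cite: Foster2024, Remark 88] -/
theorem map_eq_id_of_ne (h : Foster2024_translationAction_kumType) {n : ℕ} (hn : 2 ≤ n)
    (hp : (n + 1).Prime) {X : Motives.SchemeOver ℂ} (hX : Motives.IsSmoothProjective (2 * n) X)
    (hK : IsOfGeneralizedKummerType n X) {k : ℕ} (hk : k ≠ 2 * n) (g : Aut X)
    (hg : g ∈ autFixingH2H3 X) : complexBetti.map g.hom k = 𝟙 _ :=
  ((h n hn hX hK).2 hp).1 k hk g hg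

/-- Clause (ii) on the representation: `ρ(g) c = c` on `Hᵏ(X(ℂ); ℂ)`, `k ≠ 2n`. [cite: Foster2024, Remark 88] -/
theorem translationRep_apply_of_ne (h : Foster2024_translationAction_kumType) {n : ℕ} (hn : 2 ≤ n)
    (hp : (n + 1).Prime) {X : Motives.SchemeOver ℂ} (hX : Motives.IsSmoothProjective (2 * n) X)
    (hK : IsOfGeneralizedKummerType n X) {k : ℕ} (hk : k ≠ 2 * n) (g : autFixingH2H3 X)
    (c : complexBetti X k) : translationRep X k g c = c := by
  rw [translationRep_apply, h.map_eq_id_of_ne hn hp hX hK hk _ (g⁻¹).2]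
  rfl

/-- Off the middle degree the augmentation submodule vanishes: `𝒦(Hᵏ) = 0`, `k ≠ 2n`. [cite: Foster2024, Remark 88] -/
theorem coinvariantsKer_eq_bot_of_ne (h : Foster2024_translationAction_kumType) {n : ℕ} (hn : 2 ≤ n)
    (hp : (n + 1).Prime) {X : Motives.SchemeOver ℂ} (hX : Motives.IsSmoothProjective (2 * n) X)
    (hK : IsOfGeneralizedKummerType n X) {k : ℕ} (hk : k ≠ 2 * n) :
    Representation.Coinvariants.ker (translationRep X k) = ⊥ := by
  rw [eq_bot_iff, Representation.Coinvariants.ker, Submodule.span_le]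
  rintro _ ⟨⟨g, c⟩, rfl⟩
  have htriv : translationRep X k g c = c := h.translationRep_apply_of_ne hn hp hX hK hk g c
  simp [htriv]

/-- Clause (iii): `H^{2n}(X(ℂ); ℂ) = (invariants) + span(Γ(X)·v)` for one `v`. [cite: Foster2024, Prop. 87, Remark 88] -/
theorem exists_orbit_span (h : Foster2024_translationAction_kumType) {n : ℕ} (hn : 2 ≤ n)
    (hp : (n + 1).Prime) {X : Motives.SchemeOver ℂ} (hX : Motives.IsSmoothProjective (2 * n) X)
    (hK : IsOfGeneralizedKummerType n X) :
    ∃ v : complexBetti X (2 * n), ∀ c : complexBetti X (2 * n),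
      c ∈ (translationRep X (2 * n)).invariants ⊔
        Submodule.span ℂ (Set.range fun g : autFixingH2H3 X => translationRep X (2 * n) g v) :=
  ((h n hn hX hK).2 hp).2.1

/-- **PROVED dimension form: `dim_ℂ 𝒦(H^{2n}(X(ℂ); ℂ)) ≤ (n+1)⁴ − 1 = |Γ(X)| − 1`** — from clause (iii)
(one orbit) and `|Γ(X)| = (n+1)⁴` (`FloccariVaresco2024_autFixingH2H3_equiv_kumType.card_eq`): every
non-trivial character of `Γ(X)` occurs at most once.  Numerically `80, 624, 2400, 14640` for
`n + 1 = 3, 5, 7, 11`. [cite: Foster2024, Remark 88] [cite: FloccariVaresco2024, §3 first paragraph] -/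
theorem finrank_coinvariantsKer_le (h : Foster2024_translationAction_kumType)
    (hFV : FloccariVaresco2024_autFixingH2H3_equiv_kumType) {n : ℕ} (hn : 2 ≤ n) (hp : (n + 1).Prime)
    {X : Motives.SchemeOver ℂ} (hX : Motives.IsSmoothProjective (2 * n) X)
    (hK : IsOfGeneralizedKummerType n X) :
    Module.finrank ℂ (Representation.Coinvariants.ker (translationRep X (2 * n))) ≤ (n + 1) ^ 4 - 1 := by
  have hcard : Nat.card (autFixingH2H3 X) = (n + 1) ^ 4 := hFV.card_eq hn hX hK
  haveI : Finite (autFixingH2H3 X) := Nat.finite_of_card_ne_zero (by rw [hcard]; positivity)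
  obtain ⟨v, hv⟩ := h.exists_orbit_span hn hp hX hK
  rw [← hcard]
  exact finrank_coinvariantsKer_le_of_orbit_span (translationRep X (2 * n)) v hv

/-- **PROVED dimension form over `ℝ` (clause (iii′)): `dim_ℝ 𝒦(H^{2n}(X(ℂ); ℝ)) ≤ (n+1)⁴ − 1`.**
[cite: Foster2024, Remark 88] [cite: FloccariVaresco2024, §3 first paragraph] -/
theorem finrank_coinvariantsKer_real_le (h : Foster2024_translationAction_kumType)
    (hFV : FloccariVaresco2024_autFixingH2H3_equiv_kumType) {n : ℕ} (hn : 2 ≤ n) (hp : (n + 1).Prime)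
    {X : Motives.SchemeOver ℂ} (hX : Motives.IsSmoothProjective (2 * n) X)
    (hK : IsOfGeneralizedKummerType n X) :
    Module.finrank ℝ (Representation.Coinvariants.ker (translationRepReal X (2 * n))) ≤
      (n + 1) ^ 4 - 1 := by
  have hcard : Nat.card (autFixingH2H3 X) = (n + 1) ^ 4 := hFV.card_eq hn hX hK
  haveI : Finite (autFixingH2H3 X) := Nat.finite_of_card_ne_zero (by rw [hcard]; positivity)
  obtain ⟨v, hv⟩ := ((h n hn hX hK).2 hp).2.2
  rw [← hcard]
  exact finrank_coinvariantsKer_le_of_orbit_span (translationRepReal X (2 * n)) v hv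

/-! #### The `n = 4` record recovered by name; the `n = 2` spelling -/

/-- **This record (with the group record) ⟹ the `n = 4` record `Foster2024_translationAction_kum4Type`**
(`n + 1 = 5` prime: `dim 𝒦(H⁸) ≤ 624` over `ℂ` and `ℝ`, `Γ` trivial off degree `8`) — the general form
subsumes the `Kum⁴` record of `GeneralizedKummerTypeTranslationGroup`, token for token.
[cite: Foster2024, Lemma 85, Prop. 87 and Remark 88] [cite: FloccariVaresco2024, §3 first paragraph] -/
theorem kum4Type (h : Foster2024_translationAction_kumType)
    (hFV : FloccariVaresco2024_autFixingH2H3_equiv_kumType) : Foster2024_translationAction_kum4Type := by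
  intro X hX hK
  have hp : (4 + 1 : ℕ).Prime := by norm_num
  exact ⟨h.finrank_coinvariantsKer_le hFV (n := 4) (by norm_num) hp hX hK,
    h.finrank_coinvariantsKer_real_le hFV (n := 4) (by norm_num) hp hX hK,
    fun k hk g hg ↦ h.map_eq_id_of_ne (n := 4) (by norm_num) hp hX hK hk g hg⟩

/-- **`Kum²`-type (`n + 1 = 3`): `dim 𝒦(H⁴(X(ℂ); ℂ)) ≤ 80` and `Γ(X) ≅ (ℤ/3)⁴` acts trivially on `Hᵏ`,
`k ≠ 4`** — numerically Hassett–Tschinkel's "`H⁴(X) = Sym²(H²(X)) ⊕ 1⁸⁰`", `108 = 28 + 80`.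
[cite: Foster2024, Remark 88] [cite: FloccariVaresco2024, §3 first paragraph] -/
theorem kum2Type (h : Foster2024_translationAction_kumType)
    (hFV : FloccariVaresco2024_autFixingH2H3_equiv_kumType) {X : Motives.SchemeOver ℂ}
    (hX : Motives.IsSmoothProjective 4 X) (hK : IsOfGeneralizedKummerType 2 X) :
    Module.finrank ℂ (Representation.Coinvariants.ker (translationRep X 4)) ≤ 80 ∧
      ∀ (k : ℕ), k ≠ 4 → ∀ (g : autFixingH2H3 X) (c : complexBetti X k), translationRep X k g c = c := by
  have hp : (2 + 1 : ℕ).Prime := by norm_num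
  exact ⟨h.finrank_coinvariantsKer_le hFV (n := 2) (by norm_num) hp hX hK,
    fun k hk g c ↦ h.translationRep_apply_of_ne (n := 2) (by norm_num) hp hX hK hk g c⟩

/-! #### Consistency with Göttsche's Betti numbers (three records by name) -/

/-- The coinvariants `Hᵏ ⧸ 𝒦` have dimension `b_k − dim 𝒦` (rank–nullity; plumbing). [folklore] -/
private theorem finrank_coinvariants_add_finrank_ker {X : Motives.SchemeOver ℂ} {d k : ℕ}
    (hX : Motives.IsSmoothProjective d X) :
    Module.finrank ℂ (Representation.Coinvariants (translationRep X k)) +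
        Module.finrank ℂ (Representation.Coinvariants.ker (translationRep X k)) =
      Module.finrank ℂ (complexBetti X k) := by
  haveI : Module.Finite ℂ (complexBetti X k) := finite_complexBetti hX k
  exact Submodule.finrank_quotient_add_finrank _

/-- **`Kum²`-type: the `Γ(X)`-coinvariants of `H⁴(X(ℂ); ℂ)` have dimension `≥ 28 = 108 − 80`**
(Göttsche: `b₄ = 108`, carried to the type by the Kodaira record; print: `= 28 = dim Sym² H²`,
Hassett–Tschinkel 2013 Prop. 4.1).
[cite: Foster2024, Remark 88] [cite: Gottsche1993, §2.4, table (column n = 2, row ν = 4)] [cite: Kodaira2005, §2.3 Thm. 2.3] -/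
theorem le_finrank_coinvariants_kum2Type (h : Foster2024_translationAction_kumType)
    (hFV : FloccariVaresco2024_autFixingH2H3_equiv_kumType)
    (hG : Gottsche1994_bettiNumbers_generalizedKummerVariety)
    (hKod : Geometry.Kaehler.Kodaira2005_diffeomorphic_of_isDeformationEquivalent)
    {X : Motives.SchemeOver ℂ} (hX : Motives.IsSmoothProjective 4 X) (hK : IsOfGeneralizedKummerType 2 X) :
    28 ≤ Module.finrank ℂ (Representation.Coinvariants (translationRep X 4)) := by
  have hsum := finrank_coinvariants_add_finrank_ker (k := 4) hX
  have hb : Module.finrank ℂ (complexBetti X 4) = 108 := hG.kum2Type_four hKod hK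
  have hle := (h.kum2Type hFV hX hK).1
  omega

/-- **`Kum⁴`-type: the `Γ(X)`-coinvariants of `H⁸(X(ℂ); ℂ)` have dimension `≥ 422 = 1046 − 624`**
(Göttsche: `b₈ = 1046`, carried to the type by the Kodaira record; print: `dim H⁸(K⁴(A))^Γ = 422`, as
quoted in the `n = 4` file).
[cite: Foster2024, Remark 88] [cite: Gottsche1993, §2.4, table (column n = 4, row ν = 8)] [cite: Kodaira2005, §2.3 Thm. 2.3] -/
theorem le_finrank_coinvariants_kum4Type (h : Foster2024_translationAction_kumType)
    (hFV : FloccariVaresco2024_autFixingH2H3_equiv_kumType)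
    (hG : Gottsche1994_bettiNumbers_generalizedKummerVariety)
    (hKod : Geometry.Kaehler.Kodaira2005_diffeomorphic_of_isDeformationEquivalent)
    {X : Motives.SchemeOver ℂ} (hX : Motives.IsSmoothProjective 8 X) (hK : IsOfGeneralizedKummerType 4 X) :
    422 ≤ Module.finrank ℂ (Representation.Coinvariants (translationRep X 8)) := by
  have hsum := finrank_coinvariants_add_finrank_ker (k := 8) hX
  have hb : Module.finrank ℂ (complexBetti X 8) = 1046 := (hG.kum4Type_four_six_eight hKod hK).2.2
  have hle := (h.kum4Type hFV).finrank_coinvariantsKer_le hX hK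
  omega

end Foster2024_translationAction_kumType

end Literature.AlgebraicGeometry.Hyperkaehler

end
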